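import Summits.ValiantsHypothesis.ValiantsHypothesis.Theorems.LacunarySymmetroidMatrixDescartesTwoSidedTowerFlags

/-!
# `MatrixDescartes` census — two-sided (mirror) Lagrange tower: the combined test-point walk and its alternating limiting signs

HONEST FRAMING.  Object-search cell `pub-symmetroid`, crux `Theses.LacunarySymmetroid.MatrixDescartes`
(stmt-ValiantsHypothesis-18050); seat val-sym-mdr-p1 (g2).  Part of the kernel port of the cell's TWO-SIDED Lagrange tower P4
(conjb-3 g4, ROUND4-MEMO §2) in the seat's arrowhead form (`…LagrangeMirrorDefs`): for EVERY `m ≥ 1` some real symmetric FOUR-term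
lacunary `m × m` pencil has `m² + 2m` distinct positive determinant roots (`¬ PosRootLawAt m 4 ((m+1)² − 2)`).  A LOWER-bound /
construction statement in census (CONJECTURE-A) currency for the `K = 4` column; it proves nothing about the crux `MatrixDescartes`
(an upper-bound statement at fat formats), nothing about the cubic-vs-quadratic fork beyond this floor, and nothing about `VP ≠ VNP`.
No definitions in this file.

THIS FILE. `det_mlevel_consecutive_neg` (consecutive points of a mirror window straddle one mirror root), `levelSignDn_succ`, the downward walk
(`dwalk_inv`, `dwalk_step`, `dwalk_last`), `tri m + tri (m+1) = (m+1)²`, monotonicity of the `(m+1)²` combined test points (`cpts_lt_succ`),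
`Ecomb_mul_succ_neg` (incl. the CROSS junction between the two flags, via `det_top_eq : det(A₁ + tB₁) = det(C)² ε^m det(A₂ + tB₂)`),
`eventually_sign_comb`, and one large `D` for all steps (`exists_D_alternating4`). [folklore]
-/

-- `Summit.ValiantsHypothesis.ValiantsHypothesis.…` repeats a component by the D-0017 layout
-- (single-conjunct summit), which the `dupNamespace` linter flags; the name is mandated.
set_option linter.dupNamespace false

namespace Summit.ValiantsHypothesis.ValiantsHypothesis.Theorems.LacunarySymmetroidMatrixDescartes.Census.LagrangeTower

open Matrix Polynomial Finset
open scoped BigOperators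

section AsmC

open Filter Topology

/-! ### Signs of the mirror levels at consecutive test points -/

/-- **Within a mirror window**: consecutive test points straddle exactly one mirror root, so the level determinant changes sign
(`j ≤ m`, `r < j`). -/
theorem det_mlevel_consecutive_neg (m j r : ℕ) (hj : j ≤ m) (hr : r < j) :
    Matrix.det ((mtower m j).A + spt (2 * m - j) r • (mtower m j).B) *
      Matrix.det ((mtower m j).A + spt (2 * m - j) (r + 1) • (mtower m j).B) < 0 := by
  have hg := mtower_goodAt m j hj
  set d := mtower m j
  set w := 2 * m - j with hw
  have h1 := det_levelAt d hg (spt w r)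
  have h2 := det_levelAt d hg (spt w (r + 1))
  have hW : 0 < d.W.det ^ 2 := by have := det_W_ne_zero_of_goodAt d hg; positivity
  have hβ : ∀ i, d.β i ≠ 0 := fun i h0 => by
    have := hg.2.2.2 i; rw [h0, mul_zero] at this; exact lt_irrefl _ this
  have hprod : (∏ i, d.β i * (spt w r - mroot m j i)) * (∏ i, d.β i * (spt w (r + 1) - mroot m j i)) < 0 := by
    rw [← Finset.prod_mul_distrib]
    let i₀ : Fin j := ⟨r, hr⟩
    rw [← Finset.mul_prod_erase _ _ (Finset.mem_univ i₀)]
    have hneg : d.β i₀ * (spt w r - mroot m j i₀) * (d.β i₀ * (spt w (r + 1) - mroot m j i₀)) < 0 := by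
      have ha : spt w r - mroot m j i₀ < 0 := sub_neg.mpr ((spt_lt_zwin_iff w r i₀).mpr le_rfl)
      have hc : 0 < spt w (r + 1) - mroot m j i₀ := sub_pos.mpr ((zwin_lt_spt_iff w (r + 1) i₀).mpr (Nat.lt_succ_self r))
      have : d.β i₀ * (spt w r - mroot m j i₀) * (d.β i₀ * (spt w (r + 1) - mroot m j i₀))
          = (d.β i₀ * d.β i₀) * ((spt w r - mroot m j i₀) * (spt w (r + 1) - mroot m j i₀)) := by ring
      rw [this]
      exact mul_neg_of_pos_of_neg (mul_self_pos.mpr (hβ i₀)) (mul_neg_of_neg_of_pos ha hc)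
    have hpos : 0 < ∏ i ∈ univ.erase i₀, d.β i * (spt w r - mroot m j i) * (d.β i * (spt w (r + 1) - mroot m j i)) := by
      refine Finset.prod_pos fun i hi => ?_
      have hne : (i : ℕ) ≠ r := fun h => (Finset.mem_erase.mp hi).1 (Fin.ext h)
      have : d.β i * (spt w r - mroot m j i) * (d.β i * (spt w (r + 1) - mroot m j i))
          = (d.β i * d.β i) * ((spt w r - mroot m j i) * (spt w (r + 1) - mroot m j i)) := by ring
      rw [this]
      refine mul_pos (mul_self_pos.mpr (hβ i)) ?_
      rcases Nat.lt_or_gt_of_ne hne with hlt | hgt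
      · have ha : 0 < spt w r - mroot m j i := sub_pos.mpr ((zwin_lt_spt_iff w r i).mpr hlt)
        have hc : 0 < spt w (r + 1) - mroot m j i := sub_pos.mpr ((zwin_lt_spt_iff w (r + 1) i).mpr (by omega))
        exact mul_pos ha hc
      · have ha : spt w r - mroot m j i < 0 := sub_neg.mpr ((spt_lt_zwin_iff w r i).mpr hgt.le)
        have hc : spt w (r + 1) - mroot m j i < 0 := sub_neg.mpr ((spt_lt_zwin_iff w (r + 1) i).mpr (by omega))
        exact mul_pos_of_neg_of_neg ha hc
    exact mul_neg_of_neg_of_pos hneg hpos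
  rw [← h1, ← h2] at hprod
  have : d.W.det ^ 2 * Matrix.det (d.A + spt w r • d.B) * (d.W.det ^ 2 * Matrix.det (d.A + spt w (r + 1) • d.B))
      = (d.W.det ^ 2 * d.W.det ^ 2) * (Matrix.det (d.A + spt w r • d.B) * Matrix.det (d.A + spt w (r + 1) • d.B)) := by
    ring
  rw [this] at hprod
  rcases mul_neg_iff.mp hprod with ⟨_, h⟩ | ⟨h, _⟩
  · exact h
  · exact absurd h (not_lt.mpr (by positivity))

/-- `levelSignDn m j = sgnDn m j · levelSignDn m (j+1)` for `j < m`. -/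
theorem levelSignDn_succ {m j : ℕ} (hj : j < m) : levelSignDn m j = sgnDn m j * levelSignDn m (j + 1) := by
  unfold levelSignDn
  have : univ.filter (fun a : Fin m => j ≤ (a : ℕ)) = insert ⟨j, hj⟩ (univ.filter (fun a : Fin m => j + 1 ≤ (a : ℕ))) := by
    ext a
    simp only [Finset.mem_filter, Finset.mem_univ, true_and, Finset.mem_insert, Fin.ext_iff]
    omega
  rw [this, Finset.prod_insert]
  simp

/-- `levelSignDn m m = 1` (no downward coordinate is ON at the top level). -/
theorem levelSignDn_top (m : ℕ) : levelSignDn m m = 1 := by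
  unfold levelSignDn
  rw [Finset.prod_eq_one]
  intro a ha
  simp only [Finset.mem_filter] at ha
  exact absurd ha.2 (not_le.mpr a.isLt)

/-- `levelSign m m = 1`. -/
theorem levelSign_top (m : ℕ) : levelSign m m = 1 := by
  unfold levelSign
  rw [Finset.prod_eq_one]
  intro a ha
  simp only [Finset.mem_filter] at ha
  exact absurd ha.2 (not_le.mpr a.isLt)

/-! ### The downward walk -/

/-- `tri a ≤ tri (a + c)` (monotonicity of the triangular numbers, additive form). -/
theorem tri_le_tri_add (a c : ℕ) : tri a ≤ tri (a + c) := by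
  induction c with
  | zero => exact le_rfl
  | succ c ih =>
    have : tri (a + (c + 1)) = tri (a + c) + (a + c + 1) := rfl
    omega

/-- One step of the downward walk (definitional unfolding). -/
theorem dwalk_succ (n : ℕ) :
    dwalk (n + 1) = if (dwalk n).2 < (dwalk n).1 then ((dwalk n).1, (dwalk n).2 + 1) else ((dwalk n).1 + 1, 0) := rfl

/-- Downward-walk invariant: position `tri j + r = n` and `r ≤ j`. -/
theorem dwalk_inv : ∀ n : ℕ, tri (dwalk n).1 + (dwalk n).2 = n ∧ (dwalk n).2 ≤ (dwalk n).1
  | 0 => by simp [dwalk, tri]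
  | n + 1 => by
    obtain ⟨h1, h2⟩ := dwalk_inv n
    rw [dwalk_succ]
    by_cases hlt : (dwalk n).2 < (dwalk n).1
    · rw [if_pos hlt]; simp only; omega
    · rw [if_neg hlt]
      have heq : (dwalk n).2 = (dwalk n).1 := le_antisymm h2 (not_lt.mp hlt)
      have htri : tri ((dwalk n).1 + 1) = tri (dwalk n).1 + ((dwalk n).1 + 1) := rfl
      simp only
      omega

/-- The two kinds of steps of the downward walk. -/
theorem dwalk_step (n : ℕ) :
    ((dwalk n).2 < (dwalk n).1 ∧ dwalk (n + 1) = ((dwalk n).1, (dwalk n).2 + 1)) ∨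
    ((dwalk n).2 = (dwalk n).1 ∧ dwalk (n + 1) = ((dwalk n).1 + 1, 0)) := by
  obtain ⟨_, h2⟩ := dwalk_inv n
  rw [dwalk_succ]
  by_cases hlt : (dwalk n).2 < (dwalk n).1
  · exact Or.inl ⟨hlt, by rw [if_pos hlt]⟩
  · exact Or.inr ⟨le_antisymm h2 (not_lt.mp hlt), by rw [if_neg hlt]⟩

/-- Before `tri m` steps the downward walk stays in levels `< m`. -/
theorem dwalk_lt {m n : ℕ} (hn : n < tri m) : (dwalk n).1 < m := by
  obtain ⟨h1, _⟩ := dwalk_inv n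
  by_contra h
  obtain ⟨c, hc⟩ := Nat.exists_eq_add_of_le (not_lt.mp h)
  have := tri_le_tri_add m c
  rw [← hc] at this
  omega

/-- The last downward state is the top point of mirror level `m − 1`. -/
theorem dwalk_last {m : ℕ} (hm : 1 ≤ m) : dwalk (tri m - 1) = (m - 1, m - 1) := by
  obtain ⟨h1, h2⟩ := dwalk_inv (tri m - 1)
  have htm : tri m = tri (m - 1) + m := by
    obtain ⟨m', rfl⟩ : ∃ m', m = m' + 1 := ⟨m - 1, by omega⟩
    rw [show m' + 1 - 1 = m' from rfl]; rfl
  have hlt : (dwalk (tri m - 1)).1 < m := dwalk_lt (by omega)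
  have hj : (dwalk (tri m - 1)).1 = m - 1 := by
    by_contra hne
    have hle : (dwalk (tri m - 1)).1 + 1 ≤ m - 1 := by omega
    obtain ⟨c, hc⟩ := Nat.exists_eq_add_of_le hle
    have := tri_le_tri_add ((dwalk (tri m - 1)).1 + 1) c
    rw [← hc] at this
    have htri : tri ((dwalk (tri m - 1)).1 + 1) = tri (dwalk (tri m - 1)).1 + ((dwalk (tri m - 1)).1 + 1) := rfl
    omega
  have hr : (dwalk (tri m - 1)).2 = m - 1 := by rw [hj] at h1; omega
  exact Prod.ext hj hr

/-- `tri m + tri (m+1) = (m+1)²`. -/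
theorem tri_add_tri_succ : ∀ m : ℕ, tri m + tri (m + 1) = (m + 1) ^ 2
  | 0 => by simp [tri]
  | m + 1 => by
    have ih := tri_add_tri_succ m
    have h1 : tri (m + 2) = tri (m + 1) + (m + 2) := rfl
    have h2 : tri (m + 1) = tri m + (m + 1) := rfl
    rw [show m + 1 + 1 = m + 2 from rfl, h1]
    nlinarith [ih, h2]

/-! ### The combined test points and limiting data -/

/-- A downward test point, explicitly. -/
theorem cpts_of_lt {m n : ℕ} (hn : n < tri m) : cpts m n = spt (2 * m - (dwalk n).1) (dwalk n).2 := by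
  unfold cpts; rw [if_pos hn]

/-- An upward test point, explicitly. -/
theorem cpts_of_ge {m n : ℕ} (hn : tri m ≤ n) : cpts m n = pts m (n - tri m) := by
  unfold cpts; rw [if_neg (not_lt.mpr hn)]

/-- The limiting datum at a downward test point, explicitly. -/
theorem Ecomb_of_lt {m n : ℕ} (hn : n < tri m) :
    Ecomb m n = congEps m ^ m * levelSignDn m (dwalk n).1 *
      Matrix.det ((mtower m (dwalk n).1).A + cpts m n • (mtower m (dwalk n).1).B) := by
  unfold Ecomb; rw [if_pos hn]

/-- The limiting datum at an upward test point, explicitly. -/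
theorem Ecomb_of_ge {m n : ℕ} (hn : tri m ≤ n) : Ecomb m n = Ewalk m (n - tri m) := by
  unfold Ecomb; rw [if_neg (not_lt.mpr hn)]

/-- The combined test points are positive. -/
theorem cpts_pos (m n : ℕ) : 0 < cpts m n := by
  unfold cpts; split_ifs
  · exact spt_pos _ _
  · exact pts_pos _ _

/-- The combined test points increase. -/
theorem cpts_lt_succ (m n : ℕ) (hm : 1 ≤ m) (hn : n + 1 < tri m + tri (m + 1)) : cpts m n < cpts m (n + 1) := by
  rcases Nat.lt_or_ge (n + 1) (tri m) with hlt | hge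
  · -- both downward
    rw [cpts_of_lt (by omega), cpts_of_lt hlt]
    have hjm : (dwalk (n + 1)).1 < m := dwalk_lt hlt
    rcases dwalk_step n with ⟨hr, hw⟩ | ⟨heq, hw⟩
    · rw [hw]; exact spt_strictMono_r _ (Nat.lt_succ_self _)
    · rw [hw] at hjm ⊢
      simp only at hjm ⊢
      have := (dwalk_inv n).2
      exact spt_lt_spt_of_lt (by omega) (by omega)
  · rcases Nat.lt_or_ge n (tri m) with hlt' | hge'
    · -- the cross junction: `n = tri m − 1`
      have hn' : n = tri m - 1 := by omega
      rw [cpts_of_lt hlt', cpts_of_ge hge, hn', dwalk_last hm, show tri m - 1 + 1 - tri m = 0 by omega]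
      simp only
      unfold pts
      rw [walk_zero]
      simp only
      exact spt_lt_spt_of_lt (by omega) (by omega)
    · rw [cpts_of_ge hge', cpts_of_ge hge, show n + 1 - tri m = (n - tri m) + 1 by omega]
      exact pts_lt_succ m (n - tri m) (by omega)

/-- `det C ≠ 0`. -/
theorem det_congC_ne_zero (m : ℕ) : (congC m).det ≠ 0 := by
  intro h
  have := congrArg Matrix.det (congC_mul_congCinv m)
  rw [Matrix.det_mul, h, zero_mul, Matrix.det_one] at this
  exact zero_ne_one this

/-- The up-tower determinant at `t` in terms of the mirror top level: `det(A₁ + tB₁) = det(C)² ε^m det(A₂ + tB₂)`. -/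
theorem det_top_eq (m : ℕ) (t : ℝ) :
    Matrix.det ((tower m).A + t • (tower m).B)
      = (congC m).det ^ 2 * (congEps m ^ m * Matrix.det ((mtower m m).A + t • (mtower m m).B)) := by
  rw [← congC_conj m t, Matrix.det_mul, Matrix.det_mul, Matrix.det_transpose, Matrix.det_smul, Fintype.card_fin]
  ring

/-- **Consecutive limiting signs are opposite** along the combined walk. -/
theorem Ecomb_mul_succ_neg (m n : ℕ) (hm : 1 ≤ m) (hn : n + 1 < tri m + tri (m + 1)) :
    Ecomb m n * Ecomb m (n + 1) < 0 := by
  rcases Nat.lt_or_ge (n + 1) (tri m) with hlt | hge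
  · -- both downward
    have hn' : n < tri m := by omega
    rw [Ecomb_of_lt hn', Ecomb_of_lt hlt, cpts_of_lt hn', cpts_of_lt hlt]
    have hjm : (dwalk (n + 1)).1 < m := dwalk_lt hlt
    have hεm : 0 < congEps m ^ m * congEps m ^ m := by
      rw [← pow_add, ← two_mul, pow_mul]
      exact pow_pos (by rcases congEps_cases m with h | h <;> rw [h] <;> norm_num) _
    rcases dwalk_step n with ⟨hr, hw⟩ | ⟨heq, hw⟩
    · rw [hw] at hjm ⊢
      simp only at hjm ⊢
      set j := (dwalk n).1
      have hneg := det_mlevel_consecutive_neg m j (dwalk n).2 hjm.le hr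
      have hL := levelSignDn_ne_zero m j
      have : congEps m ^ m * levelSignDn m j * Matrix.det ((mtower m j).A + spt (2 * m - j) (dwalk n).2 • (mtower m j).B) *
          (congEps m ^ m * levelSignDn m j * Matrix.det ((mtower m j).A + spt (2 * m - j) ((dwalk n).2 + 1) • (mtower m j).B))
          = (congEps m ^ m * congEps m ^ m) * (levelSignDn m j * levelSignDn m j) *
            (Matrix.det ((mtower m j).A + spt (2 * m - j) (dwalk n).2 • (mtower m j).B) *
              Matrix.det ((mtower m j).A + spt (2 * m - j) ((dwalk n).2 + 1) • (mtower m j).B)) := by ring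
      rw [this]
      exact mul_neg_of_pos_of_neg (mul_pos hεm (mul_self_pos.mpr hL)) hneg
    · -- level change `j → j+1` inside the downward system
      rw [hw] at hjm ⊢
      simp only at hjm ⊢
      set j := (dwalk n).1 with hjdef
      rw [heq, levelSignDn_succ (show j < m by omega)]
      have hL := levelSignDn_ne_zero m (j + 1)
      have hs : sgnDn m j = -(Matrix.det ((mtower m j).A + spt (2 * m - j) j • (mtower m j).B) *
          Matrix.det ((mtower m (j + 1)).A + spt (2 * m - j - 1) 0 • (mtower m (j + 1)).B)) := rfl
      set P := Matrix.det ((mtower m j).A + spt (2 * m - j) j • (mtower m j).B)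
      set Q := Matrix.det ((mtower m (j + 1)).A + spt (2 * m - (j + 1)) 0 • (mtower m (j + 1)).B)
      have hQ' : Matrix.det ((mtower m (j + 1)).A + spt (2 * m - j - 1) 0 • (mtower m (j + 1)).B) = Q := by
        rw [show 2 * m - j - 1 = 2 * m - (j + 1) by omega]
      rw [hQ'] at hs
      have hP : P ≠ 0 := det_mlevel_spt_ne_zero m j (by omega) j
      have hQ : Q ≠ 0 := det_mlevel_spt_ne_zero m (j + 1) (by omega) 0
      rw [hs]
      have : congEps m ^ m * (-(P * Q) * levelSignDn m (j + 1)) * P * (congEps m ^ m * levelSignDn m (j + 1) * Q)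
          = -((congEps m ^ m * congEps m ^ m) * (levelSignDn m (j + 1) * levelSignDn m (j + 1)) * ((P * Q) * (P * Q))) := by
        ring
      rw [this]
      exact neg_neg_of_pos (mul_pos (mul_pos hεm (mul_self_pos.mpr hL)) (mul_self_pos.mpr (mul_ne_zero hP hQ)))
  · rcases Nat.lt_or_ge n (tri m) with hlt' | hge'
    · -- the CROSS junction `n = tri m − 1`: top of mirror level m−1 → bottom of up-window m
      have hn' : n = tri m - 1 := by omega
      rw [Ecomb_of_lt hlt', Ecomb_of_ge hge, cpts_of_lt hlt', hn', dwalk_last hm,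
        show tri m - 1 + 1 - tri m = 0 by omega]
      simp only
      unfold Ewalk pts
      rw [walk_zero]
      simp only
      rw [levelSign_top, one_mul, det_top_eq]
      obtain ⟨m', rfl⟩ : ∃ m', m = m' + 1 := ⟨m - 1, by omega⟩
      rw [show m' + 1 - 1 = m' from rfl, levelSignDn_succ (Nat.lt_succ_self m'), levelSignDn_top, mul_one]
      have hs : sgnDn (m' + 1) m' = -(Matrix.det ((mtower (m' + 1) m').A + spt (2 * (m' + 1) - m') m' • (mtower (m' + 1) m').B) *
          Matrix.det ((mtower (m' + 1) (m' + 1)).A + spt (2 * (m' + 1) - m' - 1) 0 • (mtower (m' + 1) (m' + 1)).B)) := rfl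
      set P := Matrix.det ((mtower (m' + 1) m').A + spt (2 * (m' + 1) - m') m' • (mtower (m' + 1) m').B)
      set Q := Matrix.det ((mtower (m' + 1) (m' + 1)).A + spt (m' + 1) 0 • (mtower (m' + 1) (m' + 1)).B)
      have hQ' : Matrix.det ((mtower (m' + 1) (m' + 1)).A + spt (2 * (m' + 1) - m' - 1) 0 • (mtower (m' + 1) (m' + 1)).B) = Q := by
        rw [show 2 * (m' + 1) - m' - 1 = m' + 1 by omega]
      rw [hQ'] at hs
      have hP : P ≠ 0 := det_mlevel_spt_ne_zero (m' + 1) m' (by omega) m'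
      have hQ : Q ≠ 0 := by
        have := det_mlevel_spt_ne_zero (m' + 1) (m' + 1) le_rfl 0
        rwa [show 2 * (m' + 1) - (m' + 1) = m' + 1 by omega] at this
      have hC := det_congC_ne_zero (m' + 1)
      have hεm : 0 < congEps (m' + 1) ^ (m' + 1) * congEps (m' + 1) ^ (m' + 1) := by
        rw [← pow_add, ← two_mul, pow_mul]
        exact pow_pos (by rcases congEps_cases (m' + 1) with h | h <;> rw [h] <;> norm_num) _
      rw [hs]
      have : congEps (m' + 1) ^ (m' + 1) * -(P * Q) * P *
          ((congC (m' + 1)).det ^ 2 * (congEps (m' + 1) ^ (m' + 1) * Q))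
          = -((congEps (m' + 1) ^ (m' + 1) * congEps (m' + 1) ^ (m' + 1)) * (congC (m' + 1)).det ^ 2 *
              ((P * Q) * (P * Q))) := by ring
      rw [this]
      exact neg_neg_of_pos (mul_pos (mul_pos hεm (by positivity)) (mul_self_pos.mpr (mul_ne_zero hP hQ)))
    · -- both upward
      rw [Ecomb_of_ge hge', Ecomb_of_ge hge, show n + 1 - tri m = (n - tri m) + 1 by omega]
      exact Ewalk_mul_succ_neg m (n - tri m) (by omega)

/-- At every combined test point, for all large `D`, the witness determinant has the sign of `Ecomb`. -/
theorem eventually_sign_comb (m n : ℕ) (hn : n < tri m + tri (m + 1)) :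
    ∀ᶠ D : ℕ in atTop, 0 < Matrix.det (Gmat m D (cpts m n)) * Ecomb m n := by
  rcases Nat.lt_or_ge n (tri m) with hlt | hge
  · rw [Ecomb_of_lt hlt, cpts_of_lt hlt]
    have hjm : (dwalk n).1 < m := dwalk_lt hlt
    exact eventually_sign_dn m (dwalk n).1 (dwalk n).2 hjm (dwalk_inv n).2
  · rw [Ecomb_of_ge hge, cpts_of_ge hge]
    unfold Ewalk pts
    obtain ⟨h1, h2, _⟩ := walk_inv m (n - tri m) (by omega)
    exact eventually_sign_up m _ _ h2 h1

/-- **Alternation at every step of the combined walk, for one large `D`.** -/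
theorem exists_D_alternating4 (m : ℕ) (hm : 1 ≤ m) :
    ∃ D : ℕ, ∀ n : ℕ, n + 1 < tri m + tri (m + 1) →
      Matrix.det (Gmat m D (cpts m n)) * Matrix.det (Gmat m D (cpts m (n + 1))) < 0 := by
  set N := tri m + tri (m + 1) - 1
  have hall : ∀ᶠ D : ℕ in atTop, ∀ n : Fin N,
      Matrix.det (Gmat m D (cpts m n)) * Matrix.det (Gmat m D (cpts m (n + 1))) < 0 := by
    refine eventually_all.mpr fun n => ?_
    have ha := eventually_sign_comb m n (by omega)
    have hb := eventually_sign_comb m (n + 1) (by omega)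
    have hE := Ecomb_mul_succ_neg m n hm (by omega)
    filter_upwards [ha, hb] with D hDa hDb
    set x := Matrix.det (Gmat m D (cpts m n))
    set y := Matrix.det (Gmat m D (cpts m (n + 1)))
    have hxy : (x * y) * (Ecomb m n * Ecomb m (n + 1)) > 0 := by
      have : (x * y) * (Ecomb m n * Ecomb m (n + 1)) = (x * Ecomb m n) * (y * Ecomb m (n + 1)) := by ring
      rw [this]; exact mul_pos hDa hDb
    by_contra hc
    have hc' : 0 ≤ x * y := not_lt.mp hc
    have := mul_nonpos_of_nonneg_of_nonpos hc' hE.le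
    exact absurd hxy (not_lt.mpr this)
  obtain ⟨D, hD⟩ := hall.exists
  exact ⟨D, fun n hn => hD ⟨n, by omega⟩⟩


end AsmC

end Summit.ValiantsHypothesis.ValiantsHypothesis.Theorems.LacunarySymmetroidMatrixDescartes.Census.LagrangeTower
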